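import Literature.Computability.Cryptography.WordRAMStructured
import Literature.Computability.Cryptography.WordRAMProofs
import HarnessLib

/-!
# The word RAM — randomised programs in "coins first" normal form

A verification calculus for *randomised* word-RAM programs
(`Literature.Computability.Cryptography.WordRAM`, success probability `successProb` over uniform
coin vectors), reducing them to the deterministic structured layer `SProg`/`Exec` of
`Literature.Computability.Cryptography.WordRAMStructured` (which has no `rand`): a randomised
algorithm is written as

  `pre` (structured, deterministic) ; **sample `mem[RC]` random words into `mem[mem[RP]], …`** ;
  `main` (structured, deterministic) ; `halt`

(`SProg.withCoins pre RC RP main`). The prefix `pre` computes from the input how many coins are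
needed and where to put them; the sampling loop `randLoop` is the only code containing `rand`; the
body `main` is an ordinary deterministic program that reads the sampled words as data. This is
the standard normal form of a probabilistic machine as a deterministic machine with an auxiliary
random input (e.g. Arora–Barak, *Computational Complexity*, Def. 7.1 and the remark following it;
Motwani–Raghavan, *Randomized Algorithms*, §1.5), here with exact step counts:

* `randLoop i₀ RC RP` and **`run_randLoop`**: from `pc = i₀` with `mem RC = m`, `mem RP = p` the
  loop writes the words `ρ(cp) mod 2^w, …, ρ(cp+m-1) mod 2^w` to the cells `p, …, p+m-1`, ends
  with `mem RC = 0`, `mem RP = p + m`, coin position `cp + m`, at `pc = i₀ + 5`, after exactly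
  `5m + 1` steps (`coinFill` describes the memory);
* `SProg.withCoins`, `withCoins_isOracleFree`, **`outputsWithin_withCoins`**: the output/time
  certificate of the composite program from `Exec` certificates of `pre` and `main`
  (time `t₁ + (5m+1) + t₂ + 1`);
* **`le_successProb_withCoins`**: if `main`, started on the memory of `pre` filled with the coin
  block `c ∈ [2^w]^m`, halts within `T₂` steps for every `c` and outputs into `S` whenever
  `good c`, then `successProb ≥ #{c | good c} / (2^w)^m` for every time bound
  `T ≥ t₁ + (5m+1) + T₂ + 1` — the success probability of the machine is at least the
  probability of the good coin blocks (`card_filter_prefix_mul_pow_le`: the run reads only the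
  first `m` coins).

## References

* S. Arora, B. Barak, *Computational Complexity: A Modern Approach*, CUP 2009, §7.1 (Def. 7.1,
  probabilistic TMs; the equivalent "additional random input" view).
* R. Motwani, P. Raghavan, *Randomized Algorithms*, CUP 1995, §1.5 (the RAM with random words).
* T. Hagerup, *Sorting and searching on the word RAM*, STACS 1998, §2 (the machine).
-/

namespace Literature.Computability.Cryptography.WordRAM

/-! ## The coin-sampling loop -/

/-- The coin-sampling loop placed at `i₀`, with counter cell `RC` and pointer cell `RP`:
`i₀: jz [RC] (i₀+5); rand [[RP]]; [RP] := [RP] + 1; [RC] := [RC] - 1; jmp i₀`. [folklore] -/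
def randLoop (i₀ RC RP : ℕ) : List Instr :=
  [.jz (.dir RC) (i₀ + 5), .rand (.ind RP), .op .add (.dir RP) (.dir RP) (.imm 1),
    .op .sub (.dir RC) (.dir RC) (.imm 1), .jmp i₀]

/-- The sampling loop has five instructions. [folklore] -/
@[simp] theorem randLoop_length (i₀ RC RP : ℕ) : (randLoop i₀ RC RP).length = 5 := rfl

/-- No instruction of the sampling loop is an oracle query. [folklore] -/
theorem isQuery_of_mem_randLoop {i₀ RC RP : ℕ} {I : Instr} (h : I ∈ randLoop i₀ RC RP) :
    I.isQuery = false := by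
  simp only [randLoop, List.mem_cons, List.not_mem_nil, or_false] at h
  rcases h with rfl | rfl | rfl | rfl | rfl <;> rfl

/-- The memory after sampling `m` words from coin position `cp` into the cells `p, …, p + m - 1`:
counter `RC` holds `0`, pointer `RP` holds `p + m`, the segment holds `ρ (cp + j) mod 2^w`, the
rest is unchanged. [folklore] -/
def coinFill (RC RP p m cp w : ℕ) (ρ : ℕ → ℕ) (mem : ℕ → ℕ) : ℕ → ℕ := fun a =>
  if a = RC then 0 else if a = RP then p + m
  else if p ≤ a ∧ a < p + m then ρ (cp + (a - p)) % 2 ^ w else mem a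

/-- `coinFill` at the counter. [folklore] -/
theorem coinFill_counter (RC RP p m cp w : ℕ) (ρ : ℕ → ℕ) (mem : ℕ → ℕ) :
    coinFill RC RP p m cp w ρ mem RC = 0 := by simp [coinFill]

/-- `coinFill` at the pointer. [folklore] -/
theorem coinFill_pointer {RC RP : ℕ} (hne : RC ≠ RP) (p m cp w : ℕ) (ρ : ℕ → ℕ) (mem : ℕ → ℕ) :
    coinFill RC RP p m cp w ρ mem RP = p + m := by simp [coinFill, hne.symm]

/-- `coinFill` on the sampled segment. [folklore] -/
theorem coinFill_seg {RC RP p m cp w : ℕ} {ρ : ℕ → ℕ} {mem : ℕ → ℕ} (hC : RC < p) (hP : RP < p)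
    {j : ℕ} (hj : j < m) : coinFill RC RP p m cp w ρ mem (p + j) = ρ (cp + j) % 2 ^ w := by
  have h1 : p + j ≠ RC := by omega
  have h2 : p + j ≠ RP := by omega
  simp [coinFill, h1, h2, hj]

/-- `coinFill` elsewhere. [folklore] -/
theorem coinFill_of_not {RC RP p m cp w : ℕ} {ρ : ℕ → ℕ} {mem : ℕ → ℕ} {a : ℕ} (hC : a ≠ RC)
    (hP : a ≠ RP) (ha : ¬ (p ≤ a ∧ a < p + m)) : coinFill RC RP p m cp w ρ mem a = mem a := by
  simp [coinFill, hC, hP, ha]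

/-- `coinFill` ignores the counter and pointer cells and the segment of the memory it starts from.
[folklore] -/
theorem coinFill_congr {RC RP p m cp w : ℕ} {ρ : ℕ → ℕ} {mem mem' : ℕ → ℕ}
    (h : ∀ a, a ≠ RC → a ≠ RP → ¬ (p ≤ a ∧ a < p + m) → mem a = mem' a) :
    coinFill RC RP p m cp w ρ mem = coinFill RC RP p m cp w ρ mem' := by
  funext a
  by_cases hC : a = RC
  · simp [coinFill, hC]
  by_cases hP : a = RP
  · simp [coinFill, hP]
  by_cases ha : p ≤ a ∧ a < p + m
  · simp [coinFill, hC, hP, ha]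
  · rw [coinFill_of_not hC hP ha, coinFill_of_not hC hP ha, h a hC hP ha]

/-- The sampled words depend only on the coins at positions `cp, …, cp + m - 1`. [folklore] -/
theorem coinFill_congr_coins {RC RP p m cp w : ℕ} {ρ ρ' : ℕ → ℕ} {mem : ℕ → ℕ}
    (h : ∀ j, j < m → ρ (cp + j) = ρ' (cp + j)) :
    coinFill RC RP p m cp w ρ mem = coinFill RC RP p m cp w ρ' mem := by
  funext a
  unfold coinFill
  split_ifs with h1 h2 h3
  · rfl
  · rfl
  · obtain ⟨j, rfl⟩ : ∃ j, a = p + j := ⟨a - p, by omega⟩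
    rw [Nat.add_sub_cancel_left, h j (by omega)]
  · rfl

/-- One more word: sampling `m + 1` words from `p` is sampling one word into `p` (advancing
pointer, counter and coin position) and then `m` words from `p + 1`. [folklore] -/
theorem coinFill_succ {RC RP p m cp w : ℕ} (hne : RC ≠ RP) (hC : RC < p) (hP : RP < p)
    (ρ : ℕ → ℕ) (mem : ℕ → ℕ) :
    coinFill RC RP p (m + 1) cp w ρ mem =
      coinFill RC RP (p + 1) m (cp + 1) w ρ
        (Function.update (Function.update (Function.update mem p (ρ cp % 2 ^ w)) RP (p + 1)) RC m) := by
  funext a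
  by_cases h1 : a = RC
  · simp [coinFill, h1]
  by_cases h2 : a = RP
  · subst h2; simp [coinFill, hne.symm]; omega
  by_cases h3 : p ≤ a ∧ a < p + (m + 1)
  · have hL : coinFill RC RP p (m + 1) cp w ρ mem a = ρ (cp + (a - p)) % 2 ^ w := by
      simp [coinFill, h1, h2, h3]
    rw [hL]
    by_cases h4 : p + 1 ≤ a ∧ a < p + 1 + m
    · have hR : coinFill RC RP (p + 1) m (cp + 1) w ρ
          (Function.update (Function.update (Function.update mem p (ρ cp % 2 ^ w)) RP (p + 1))
            RC m) a = ρ (cp + 1 + (a - (p + 1))) % 2 ^ w := by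
        simp [coinFill, h1, h2, h4]
      rw [hR]; congr 2; omega
    · have ha : a = p := by omega
      subst ha
      rw [coinFill_of_not h1 h2 h4, Function.update_of_ne h1, Function.update_of_ne h2,
        Function.update_self, Nat.sub_self, Nat.add_zero]
  · have h4 : ¬ (p + 1 ≤ a ∧ a < p + 1 + m) := by omega
    have hp : a ≠ p := by omega
    rw [coinFill_of_not h1 h2 h3, coinFill_of_not h1 h2 h4, Function.update_of_ne h1,
      Function.update_of_ne h2, Function.update_of_ne hp]

/-- With no word to sample, `coinFill` is the memory it starts from (given the register
contents). [folklore] -/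
theorem coinFill_zero {RC RP p cp w : ℕ} (ρ : ℕ → ℕ) {mem : ℕ → ℕ} (hRC : mem RC = 0)
    (hRP : mem RP = p) : coinFill RC RP p 0 cp w ρ mem = mem := by
  funext a
  by_cases h1 : a = RC
  · simp [coinFill, h1, hRC]
  by_cases h2 : a = RP
  · subst h2; simp [coinFill, h1, hRP]
  · exact coinFill_of_not h1 h2 (by omega)

/-- **Execution of the sampling loop.** Placed at `i₀`, from `pc = i₀` with `mem RC = m`,
`mem RP = p`, registers below the segment (`RC, RP < p`, `RC ≠ RP`) and no pointer wrap-around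
(`p + m < 2^w`), the loop reaches `pc = i₀ + 5` after exactly `5m + 1` steps with memory
`coinFill RC RP p m cp w ρ mem` and coin position `cp + m`, query log unchanged. [folklore] -/
theorem run_randLoop {P : Program} {w : ℕ} {O : List ℕ → List ℕ} {ρ : ℕ → ℕ} {i₀ RC RP : ℕ}
    (hcode : CodeAt P i₀ (randLoop i₀ RC RP)) (hne : RC ≠ RP) :
    ∀ (m : ℕ) {p : ℕ} {c : Cfg}, c.pc = some i₀ → c.mem RC = m → c.mem RP = p → RC < p →
      RP < p → p + m < 2 ^ w →
      run P w O ρ (5 * m + 1) c =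
        some { c with pc := some (i₀ + 5), mem := coinFill RC RP p m c.coinPos w ρ c.mem,
                      coinPos := c.coinPos + m } := by
  have hjz : P[i₀]? = some (.jz (.dir RC) (i₀ + 5)) := hcode.getElem?_zero
  have hrand : P[i₀ + 1]? = some (.rand (.ind RP)) := hcode.tail.getElem?_zero
  have hadd : P[i₀ + 1 + 1]? = some (.op .add (.dir RP) (.dir RP) (.imm 1)) :=
    hcode.tail.tail.getElem?_zero
  have hsub : P[i₀ + 1 + 1 + 1]? = some (.op .sub (.dir RC) (.dir RC) (.imm 1)) :=
    hcode.tail.tail.tail.getElem?_zero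
  have hjmp : P[i₀ + 1 + 1 + 1 + 1]? = some (.jmp i₀) := hcode.tail.tail.tail.tail.getElem?_zero
  intro m
  induction m with
  | zero =>
    intro p c hpc hRC hRP hC hP hw
    have h0 : (Operand.dir RC).read c.mem = 0 := by simpa using hRC
    rw [Nat.mul_zero, Nat.zero_add, run_one, step_jz_zero hpc hjz h0, coinFill_zero ρ hRC hRP]
    rfl
  | succ m ih =>
    intro p c hpc hRC hRP hC hP hw
    obtain ⟨pc, mem, cp, qs⟩ := c
    simp only at hpc hRC hRP ⊢
    subst hpc
    have hpw : p < 2 ^ w := by omega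
    -- step 1: the test falls through
    have h1 : step P w O ρ ⟨some i₀, mem, cp, qs⟩ = some ⟨some (i₀ + 1), mem, cp, qs⟩ := by
      rw [step_jz_ne rfl hjz (by simp [hRC])]
    -- step 2: the random word, written at address `mem RP = p`
    set mem₂ := Function.update mem p (ρ cp % 2 ^ w) with hmem₂
    have h2 : step P w O ρ ⟨some (i₀ + 1), mem, cp, qs⟩ = some ⟨some (i₀ + 1 + 1), mem₂, cp + 1, qs⟩ := by
      rw [step_rand rfl hrand]
      simp [Operand.write, hRP, hmem₂]
    -- step 3: advance the pointer
    have hRP₂ : mem₂ RP = p := by rw [hmem₂, Function.update_of_ne (by omega), hRP]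
    have hRC₂ : mem₂ RC = m + 1 := by rw [hmem₂, Function.update_of_ne (by omega), hRC]
    set mem₃ := Function.update mem₂ RP (p + 1) with hmem₃
    have h3 : step P w O ρ ⟨some (i₀ + 1 + 1), mem₂, cp + 1, qs⟩ =
        some ⟨some (i₀ + 1 + 1 + 1), mem₃, cp + 1, qs⟩ := by
      rw [step_op rfl hadd]
      simp only [Operand.read_dir, Operand.read_imm, Operand.write, hRP₂,
        BinOp.eval_add_of_lt (show p + 1 < 2 ^ w by omega), hmem₃]
    -- step 4: decrement the counter
    have hRC₃ : mem₃ RC = m + 1 := by rw [hmem₃, Function.update_of_ne hne, hRC₂]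
    set mem₄ := Function.update mem₃ RC m with hmem₄
    have h4 : step P w O ρ ⟨some (i₀ + 1 + 1 + 1), mem₃, cp + 1, qs⟩ =
        some ⟨some (i₀ + 1 + 1 + 1 + 1), mem₄, cp + 1, qs⟩ := by
      rw [step_op rfl hsub]
      simp only [Operand.read_dir, Operand.read_imm, Operand.write, hRC₃,
        BinOp.eval_sub_of_le (show 1 ≤ m + 1 by omega) (show m + 1 < 2 ^ w by omega),
        Nat.add_sub_cancel, hmem₄]
    -- step 5: jump back
    have h5 : step P w O ρ ⟨some (i₀ + 1 + 1 + 1 + 1), mem₄, cp + 1, qs⟩ =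
        some ⟨some i₀, mem₄, cp + 1, qs⟩ := by
      rw [step_jmp rfl hjmp]
    -- the remaining `m` iterations
    have hRC₄ : mem₄ RC = m := by rw [hmem₄, Function.update_self]
    have hRP₄ : mem₄ RP = p + 1 := by
      rw [hmem₄, Function.update_of_ne hne.symm, hmem₃, Function.update_self]
    have h6 := ih (p := p + 1) (c := ⟨some i₀, mem₄, cp + 1, qs⟩) rfl hRC₄ hRP₄ (by omega)
      (by omega) (by omega)
    have hsteps : 5 * (m + 1) + 1 = (5 * m + 1) + 1 + 1 + 1 + 1 + 1 := by omega
    rw [hsteps, run_succ_of_step _ _ _ _ h1, run_succ_of_step _ _ _ _ h2,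
      run_succ_of_step _ _ _ _ h3, run_succ_of_step _ _ _ _ h4, run_succ_of_step _ _ _ _ h5, h6]
    simp only [Option.some.injEq, Cfg.mk.injEq, true_and, and_true]
    refine ⟨?_, by omega⟩
    rw [coinFill_succ hne hC hP ρ mem, hmem₄, hmem₃, hmem₂]

/-! ## Programs in coins-first normal form -/

namespace SProg

/-- **Coins-first normal form**: the structured prefix `pre`, then the sampling loop (counter
cell `RC`, pointer cell `RP`, both set by `pre`), then the structured body `main`, then `halt`.
[folklore] -/
def withCoins (pre : SProg) (RC RP : ℕ) (main : SProg) : Program :=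
  pre.compile 0 ++ randLoop pre.len RC RP ++ main.compile (pre.len + 5) ++ [.halt]

/-- A coins-first program with query-free parts is oracle-free. [folklore] -/
theorem withCoins_isOracleFree {pre main : SProg} (hpre : pre.QueryFree) (hmain : main.QueryFree)
    (RC RP : ℕ) : (withCoins pre RC RP main).IsOracleFree := by
  intro I hI
  simp only [withCoins, List.mem_append, List.mem_singleton] at hI
  rcases hI with ((h | h) | h) | rfl
  · exact isQuery_of_mem_compile pre hpre 0 I h
  · exact isQuery_of_mem_randLoop h
  · exact isQuery_of_mem_compile main hmain _ I h
  · rfl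

/-- **Output certificate of a coins-first program.** If `pre` executes from the initial store of
`x` to `st₁` in `t₁` steps, leaving `m` in `RC` and a segment address `p` in `RP` (registers below
`p`, `p + m < 2^w`), and `main` executes from the coin-filled memory
`coinFill RC RP p m 0 w ρ st₁.mem` to `st₂` in `t₂` steps, then `withCoins pre RC RP main` on
input `x` with coin stream `ρ` outputs `readOut st₂.mem` within `t₁ + (5m+1) + t₂ + 1` steps.
[folklore] -/
theorem outputsWithin_withCoins {pre main : SProg} {RC RP : ℕ} {w : ℕ} {O : List ℕ → List ℕ}
    {ρ : ℕ → ℕ} {x : List ℕ} {st₁ st₂ : Store} {t₁ t₂ m p T : ℕ}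
    (h₁ : Exec w O pre ⟨(init w x).mem, []⟩ st₁ t₁) (hRC : st₁.mem RC = m) (hRP : st₁.mem RP = p)
    (hne : RC ≠ RP) (hC : RC < p) (hP : RP < p) (hw : p + m < 2 ^ w)
    (h₂ : Exec w O main ⟨coinFill RC RP p m 0 w ρ st₁.mem, st₁.queries⟩ st₂ t₂)
    (hT : t₁ + (5 * m + 1) + t₂ + 1 ≤ T) :
    OutputsWithin (withCoins pre RC RP main) w O ρ x (readOut st₂.mem) T := by
  set P := withCoins pre RC RP main with hPdef
  have hcpre : CodeAt P 0 (pre.compile 0) := by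
    simpa [hPdef, withCoins] using
      codeAt_of_eq_append (P := P) (pre := []) (B := pre.compile 0)
        (post := randLoop pre.len RC RP ++ main.compile (pre.len + 5) ++ [.halt])
        (by simp [hPdef, withCoins])
  have hcloop : CodeAt P pre.len (randLoop pre.len RC RP) := by
    simpa using codeAt_of_eq_append (P := P) (pre := pre.compile 0) (B := randLoop pre.len RC RP)
      (post := main.compile (pre.len + 5) ++ [.halt]) (by simp [hPdef, withCoins])
  have hcmain : CodeAt P (pre.len + 5) (main.compile (pre.len + 5)) := by
    simpa using codeAt_of_eq_append (P := P) (pre := pre.compile 0 ++ randLoop pre.len RC RP)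
      (B := main.compile (pre.len + 5)) (post := [.halt]) (by simp [hPdef, withCoins])
  have hhalt : P[pre.len + 5 + main.len]? = some .halt := by
    simp [hPdef, withCoins, Nat.add_assoc]
  -- run `pre`
  have r₁ := h₁.run_eq hcpre 0 ρ
  rw [Nat.zero_add] at r₁
  have hinit : (⟨(init w x).mem, []⟩ : Store).cfg (some 0) 0 = init w x := rfl
  rw [hinit] at r₁
  -- run the sampling loop
  have r₂ := run_randLoop (O := O) (ρ := ρ) (w := w) hcloop hne m (p := p)
    (c := st₁.cfg (some pre.len) 0) rfl hRC hRP hC hP hw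
  simp only [Store.cfg_mem, Store.cfg_coinPos, Nat.zero_add] at r₂
  -- run `main`
  have r₃ := h₂.run_eq hcmain m ρ
  -- halt
  have r₄ : step P w O ρ (st₂.cfg (some (pre.len + 5 + main.len)) m) =
      some (st₂.cfg none m) := step_halt rfl hhalt
  have hrun := run_add_of_run _ _ _ _ (run_add_of_run _ _ _ _ (run_add_of_run _ _ _ _ r₁ r₂) r₃)
    (by rw [run_one, r₄])
  exact outputsWithin_of_run hrun (step_of_pc_eq_none rfl) hT

end SProg

/-! ## The success probability of a coins-first program -/

/-- Counting coin vectors by a prefix: if a property of `ρ : Fin T → F` follows from a property of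
its first `m` coordinates, then the vectors with the property are at least `|F|^{T-m}` times as
many as the good prefixes. [folklore] -/
theorem card_filter_prefix_mul_pow_le {F : Type*} [Fintype F] {m T : ℕ} (hm : m ≤ T)
    (p : (Fin m → F) → Prop) (q : (Fin T → F) → Prop) [DecidablePred p] [DecidablePred q]
    (hpq : ∀ ρ : Fin T → F, p (fun i => ρ (Fin.castLE hm i)) → q ρ) :
    (Finset.univ.filter p).card * Fintype.card F ^ (T - m) ≤ (Finset.univ.filter q).card := by
  obtain ⟨d, rfl⟩ := Nat.exists_eq_add_of_le hm
  rw [Nat.add_sub_cancel_left]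
  exact card_filter_mul_card_pow_le m d p q fun ρ hp => hpq ρ hp

/-- The memory handed to `main` when the sampled block is `c ∈ [2^w]^m`: `coinFill` with the coin
stream reading `c`. [folklore] -/
def coinBlockStream {m M : ℕ} (c : Fin m → Fin M) : ℕ → ℕ :=
  fun i => if h : i < m then (c ⟨i, h⟩ : ℕ) else 0

/-- **Success probability of a coins-first program.** Suppose `pre` executes from the initial
store of `x` in `t₁` steps to `st₁` with `m` in `RC` and `p` in `RP` (`RC ≠ RP`, both `< p`,
`p + m < 2^w`), and that for EVERY coin block `c ∈ [2^w]^m` the body `main`, started on the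
coin-filled memory, halts within `T₂` steps in a store whose read-out lies in `S` whenever
`good c`. Then for every time bound `T ≥ t₁ + (5m+1) + T₂ + 1` the success probability of
`withCoins pre RC RP main` on `x` for the target `S` is at least `#{c | good c} / (2^w)^m`.
[folklore] -/
theorem le_successProb_withCoins {pre main : SProg} {RC RP : ℕ}
    {w : ℕ} {x : List ℕ} {st₁ : Store} {t₁ m p T₂ T : ℕ}
    (h₁ : SProg.Exec w noOracle pre ⟨(init w x).mem, []⟩ st₁ t₁) (hRC : st₁.mem RC = m)
    (hRP : st₁.mem RP = p) (hne : RC ≠ RP) (hC : RC < p) (hP : RP < p) (hw : p + m < 2 ^ w)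
    (S : Set (List ℕ)) (good : (Fin m → Fin (2 ^ w)) → Prop) [DecidablePred good]
    (h₂ : ∀ c : Fin m → Fin (2 ^ w), ∃ st₂ t₂, t₂ ≤ T₂ ∧
      SProg.Exec w noOracle main ⟨coinFill RC RP p m 0 w (coinBlockStream c) st₁.mem, st₁.queries⟩
        st₂ t₂ ∧ (good c → readOut st₂.mem ∈ S))
    (hT : t₁ + (5 * m + 1) + T₂ + 1 ≤ T) :
    ((Finset.univ.filter good).card : ℝ) / ((2 : ℝ) ^ w) ^ m ≤
      successProb (SProg.withCoins pre RC RP main) w noOracle x S T := by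
  classical
  have hmT : m ≤ T := by omega
  -- every coin vector with a good prefix succeeds
  have key : ∀ ρ : Fin T → Fin (2 ^ w), good (fun i => ρ (Fin.castLE hmT i)) →
      ∃ out ∈ S, OutputsWithin (SProg.withCoins pre RC RP main) w noOracle (coinStream ρ) x out T := by
    intro ρ hgood
    obtain ⟨st₂, t₂, ht₂, hex, hout⟩ := h₂ fun i => ρ (Fin.castLE hmT i)
    refine ⟨readOut st₂.mem, hout hgood, ?_⟩
    have hfill : coinFill RC RP p m 0 w (coinStream ρ) st₁.mem =
        coinFill RC RP p m 0 w (coinBlockStream fun i => ρ (Fin.castLE hmT i)) st₁.mem := by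
      refine coinFill_congr_coins fun j hj => ?_
      simp [coinStream, coinBlockStream, hj, show j < T by omega]
    refine SProg.outputsWithin_withCoins h₁ hRC hRP hne hC hP hw (hfill ▸ hex) ?_
    omega
  have hcard := card_filter_prefix_mul_pow_le hmT
    (fun c : Fin m → Fin (2 ^ w) => good c)
    (fun ρ : Fin T → Fin (2 ^ w) =>
      ∃ out ∈ S, OutputsWithin (SProg.withCoins pre RC RP main) w noOracle (coinStream ρ) x out T)
    key
  rw [Fintype.card_fin] at hcard
  have hcardR : ((Finset.univ.filter good).card : ℝ) * ((2 : ℝ) ^ w) ^ (T - m) ≤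
      ((Finset.univ.filter fun ρ : Fin T → Fin (2 ^ w) =>
        ∃ out ∈ S, OutputsWithin (SProg.withCoins pre RC RP main) w noOracle (coinStream ρ) x out
          T).card : ℝ) := by
    exact_mod_cast hcard
  have h2 : (0 : ℝ) < (2 : ℝ) ^ w := pow_pos two_pos _
  unfold successProb
  have hpow : ((2 : ℝ) ^ w) ^ T = ((2 : ℝ) ^ w) ^ (T - m) * ((2 : ℝ) ^ w) ^ m := by
    rw [← pow_add, Nat.sub_add_cancel hmT]
  rw [div_le_div_iff₀ (pow_pos h2 _) (pow_pos h2 _), hpow, ← mul_assoc]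
  exact mul_le_mul_of_nonneg_right hcardR (pow_nonneg (pow_nonneg zero_le_two _) _)

end Literature.Computability.Cryptography.WordRAM
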